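import Summits.CriticalPhenomena.PercolationContinuityZ3.Theorems.PercNearOneGluingNoHeavyLowerTailBlockLonelyRelay
import Literature.Probability.Percolation.TwoSetConditionalAssociation
import HarnessLib

/-!
# `NoHeavyLowerTail` (stmt-CriticalPhenomena-4575) — tools for the TWO-LEVEL LONELY RELAY theorem

Support file (factory prove seat `prim-ineq-prove-3`, gen 3; `--supports stmt-CriticalPhenomena-4575`); no
definitions, no named facts.  `μ = prodBernoulli w` on `Fin n`, relays `A`, observer `o`, `C_S = ⋃_{s∈S} C_s`.
* `reachable_clusterUnion_iff` — for `x ∈ S`, `x ↔ y` is read off `C_S`, so connection / separation events of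
  vertices of `S` are monotone / antitone predicates of `C_S`;
* `twoSet_pos`, `twoSet_neg`, `sameSide_neg` — EVENT forms of van den Berg–Häggström–Kahn Thm 1.5 with sets
  (`BHK2006_twoSetConditionalAssociation`) given `{S ↮ T}`;
* `rider` — the RIDER LEMMA `μ(D ∩ {o↔W})·μ(D ∩ ({W int. connected} ∩ Q)) ≤ μ(D)·μ(D ∩ ({o↔W} ∩ (… ∩ Q)))`,
  `D = {W ↮ T}`, `Q` any pair-separation event of pairs starting in `T`: the observer reaches a REALISED block at
  least at the rate `φ(W) = P(o ↔ W | W ↮ T)` (Kozma–Nitzan Lemma 1(i) with an increasing rider on the source side);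
* `lemma2_ratio` — Kozma–Nitzan's Lemma 2 (`Σ_u φ({u}) ≤ φ(W)`, arXiv:2401.12397 p. 6) for designated
  singletons `u ∈ U ⊆ W`, in ratio form under positivity of the separation event.
-/

namespace Summit.CriticalPhenomena.PercolationContinuityZ3.Theorems

open scoped BigOperators Classical
open MeasureTheory Set
open Literature.Probability.LatticeModels (prodBernoulli)
open Literature.Probability.Percolation
open TripodExchange TwoSetConditionalAssociation

variable {n : ℕ}

namespace TwoLevelLonelyRelay

/-- Every edge of an open walk from `x` lies in the open edge cluster of `x`. [folklore] -/
theorem walk_edges_mem_openEdgeCluster {V : Type*} (ω : BondConfig V) {x y : V}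
    (p : (openGraph ω).Walk x y) : ∀ e ∈ p.edges, e ∈ openEdgeCluster ω x := by
  induction p with
  | nil => intro e he; simp at he
  | @cons u v w' h q ih =>
    intro e he
    rw [SimpleGraph.Walk.edges_cons, List.mem_cons] at he
    have huv := (openGraph_adj ω u v).1 h
    rcases he with rfl | he
    · refine (mem_openEdgeCluster_iff ω u _).2 ⟨huv.1, by rw [Sym2.mk_isDiag_iff]; exact huv.2, ?_⟩
      intro z hz
      rcases Sym2.mem_iff.1 hz with rfl | rfl
      exacts [SimpleGraph.Reachable.refl _, h.reachable]
    · have he' := (mem_openEdgeCluster_iff ω v e).1 (ih e he)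
      exact (mem_openEdgeCluster_iff ω u e).2 ⟨he'.1, he'.2.1, fun z hz => h.reachable.trans (he'.2.2 z hz)⟩

/-- For `x ∈ S`: `x ↔ y` in `ω` iff `x ↔ y` in the graph of the edge set `C_S = ⋃_{s ∈ S} C_s`. [folklore] -/
theorem reachable_clusterUnion_iff {V : Type*} (ω : BondConfig V) (S : Set V) {x : V} (hx : x ∈ S)
    (y : V) :
    (SimpleGraph.fromEdgeSet (⋃ s ∈ S, openEdgeCluster ω s)).Reachable x y ↔
      (openGraph ω).Reachable x y := by
  constructor
  · exact fun h => h.mono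
      (SimpleGraph.fromEdgeSet_mono (Set.iUnion₂_subset fun s _ => openEdgeCluster_subset ω s))
  · rintro ⟨p⟩
    refine ⟨p.transfer (SimpleGraph.fromEdgeSet (⋃ s ∈ S, openEdgeCluster ω s)) fun e he => ?_⟩
    rw [SimpleGraph.edgeSet_fromEdgeSet]
    exact ⟨Set.mem_iUnion₂.2 ⟨x, hx, walk_edges_mem_openEdgeCluster ω p e he⟩,
      ((mem_openEdgeCluster_iff ω x e).1 (walk_edges_mem_openEdgeCluster ω p e he)).2.1⟩

/-- Monotonicity of reachability in the edge set. [folklore] -/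
theorem reachable_fromEdgeSet_mono {V : Type*} {C C' : Set (Sym2 V)} (h : C ⊆ C') {x y : V}
    (hxy : (SimpleGraph.fromEdgeSet C).Reachable x y) : (SimpleGraph.fromEdgeSet C').Reachable x y :=
  hxy.mono (SimpleGraph.fromEdgeSet_mono h)

/-- Indicator of a conjunction `P C ∧ R E`: monotone in `C` when `P` is. [folklore] -/
theorem ite_and_monotone_left {V : Type*} {P R : Set (Sym2 V) → Prop}
    (hP : ∀ ⦃C C' : Set (Sym2 V)⦄, C ⊆ C' → P C → P C') (E : Set (Sym2 V)) :
    Monotone fun C => (if P C ∧ R E then (1 : ℝ) else 0) := by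
  intro C C' hCC'; dsimp only; by_cases h : P C ∧ R E
  · rw [if_pos h, if_pos ⟨hP hCC' h.1, h.2⟩]
  · rw [if_neg h]; split_ifs <;> norm_num

/-- Indicator of a conjunction `P C ∧ R E`: antitone in `E` when `R` is. [folklore] -/
theorem ite_and_antitone_right {V : Type*} {P R : Set (Sym2 V) → Prop}
    (hR : ∀ ⦃E E' : Set (Sym2 V)⦄, E ⊆ E' → R E' → R E) (C : Set (Sym2 V)) :
    Antitone fun E => (if P C ∧ R E then (1 : ℝ) else 0) := by
  intro E E' hEE'; dsimp only; by_cases h : P C ∧ R E'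
  · rw [if_pos h, if_pos ⟨h.1, hR hEE' h.2⟩]
  · rw [if_neg h]; split_ifs <;> norm_num

/-- Negated indicator of an antitone predicate is monotone. [folklore] -/
theorem neg_ite_monotone_of_antitone {V : Type*} {R : Set (Sym2 V) → Prop}
    (hR : ∀ ⦃E E' : Set (Sym2 V)⦄, E ⊆ E' → R E' → R E) :
    Monotone fun E => -(if R E then (1 : ℝ) else 0) := by
  intro E E' hEE'; dsimp only; by_cases h : R E'
  · rw [if_pos h, if_pos (hR hEE' h)]
  · rw [if_neg h]; split_ifs <;> norm_num

/-- **Two-set BHK, event form, positive case.**  Given `D = {S ↮ T}`: for `P, P'` increasing on `C_S` and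
`R` decreasing on `C_T`,  `μ(D ∩ {P}) · μ(D ∩ {P' ∧ R}) ≤ μ(D) · μ(D ∩ ({P} ∩ {P' ∧ R}))`.
[cite: VandenbergHaggstromKahn2005, Thm. 2.1 (p. 9) at q = 1 — event corollary] -/
theorem twoSet_pos (w : Sym2 (Fin n) → unitInterval) (S T : Set (Fin n))
    (P P' R : Set (Sym2 (Fin n)) → Prop)
    (hP : ∀ ⦃C C' : Set (Sym2 (Fin n))⦄, C ⊆ C' → P C → P C')
    (hP' : ∀ ⦃C C' : Set (Sym2 (Fin n))⦄, C ⊆ C' → P' C → P' C')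
    (hR : ∀ ⦃E E' : Set (Sym2 (Fin n))⦄, E ⊆ E' → R E' → R E) :
    (prodBernoulli w).real ({ω : BondConfig (Fin n) | ∀ s ∈ S, ∀ t ∈ T, ¬ (openGraph ω).Reachable s t} ∩
        {ω | P (⋃ s ∈ S, openEdgeCluster ω s)}) *
      (prodBernoulli w).real ({ω : BondConfig (Fin n) | ∀ s ∈ S, ∀ t ∈ T, ¬ (openGraph ω).Reachable s t} ∩
        {ω | P' (⋃ s ∈ S, openEdgeCluster ω s) ∧ R (⋃ t ∈ T, openEdgeCluster ω t)}) ≤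
    (prodBernoulli w).real {ω : BondConfig (Fin n) | ∀ s ∈ S, ∀ t ∈ T, ¬ (openGraph ω).Reachable s t} *
      (prodBernoulli w).real ({ω : BondConfig (Fin n) | ∀ s ∈ S, ∀ t ∈ T, ¬ (openGraph ω).Reachable s t} ∩
        ({ω | P (⋃ s ∈ S, openEdgeCluster ω s)} ∩
          {ω | P' (⋃ s ∈ S, openEdgeCluster ω s) ∧ R (⋃ t ∈ T, openEdgeCluster ω t)})) := by
  classical
  have key := BHK2006_twoSetConditionalAssociation w S T
    (fun C _ => if P C then (1 : ℝ) else 0) (fun C E => if P' C ∧ R E then (1 : ℝ) else 0)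
    (fun _ => predIndicator_monotone hP) (fun _ => antitone_const)
    (fun E => ite_and_monotone_left hP' E) (fun C => ite_and_antitone_right hR C)
  simp only [predIndicator_eq_indicator (fun ω => P (⋃ s ∈ S, openEdgeCluster ω s)),
    predIndicator_eq_indicator (fun ω => P' (⋃ s ∈ S, openEdgeCluster ω s) ∧
      R (⋃ t ∈ T, openEdgeCluster ω t)),
    setIntegral_indicator_one_eq, setIntegral_indicator_mul_indicator_eq] at key
  exact key

/-- **Two-set BHK, event form, negative case.**  Given `D = {S ↮ T}`: for `P` increasing on `C_S` and `Q`
increasing on `C_T`,  `μ(D) · μ(D ∩ ({P} ∩ {Q})) ≤ μ(D ∩ {P}) · μ(D ∩ {Q})`.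
[cite: VandenbergHaggstromKahn2005, Thm. 1.4 with sets (Remark 1, p. 5) — event corollary] -/
theorem twoSet_neg (w : Sym2 (Fin n) → unitInterval) (S T : Set (Fin n))
    (P Q : Set (Sym2 (Fin n)) → Prop)
    (hP : ∀ ⦃C C' : Set (Sym2 (Fin n))⦄, C ⊆ C' → P C → P C')
    (hQ : ∀ ⦃E E' : Set (Sym2 (Fin n))⦄, E ⊆ E' → Q E → Q E') :
    (prodBernoulli w).real {ω : BondConfig (Fin n) | ∀ s ∈ S, ∀ t ∈ T, ¬ (openGraph ω).Reachable s t} *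
      (prodBernoulli w).real ({ω : BondConfig (Fin n) | ∀ s ∈ S, ∀ t ∈ T, ¬ (openGraph ω).Reachable s t} ∩
        ({ω | P (⋃ s ∈ S, openEdgeCluster ω s)} ∩ {ω | Q (⋃ t ∈ T, openEdgeCluster ω t)})) ≤
    (prodBernoulli w).real ({ω : BondConfig (Fin n) | ∀ s ∈ S, ∀ t ∈ T, ¬ (openGraph ω).Reachable s t} ∩
        {ω | P (⋃ s ∈ S, openEdgeCluster ω s)}) *
      (prodBernoulli w).real ({ω : BondConfig (Fin n) | ∀ s ∈ S, ∀ t ∈ T, ¬ (openGraph ω).Reachable s t} ∩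
        {ω | Q (⋃ t ∈ T, openEdgeCluster ω t)}) := by
  classical
  have key := BHK2006_twoSetConditionalAssociation.negCorrelation w S T
    (fun C => if P C then (1 : ℝ) else 0) (fun E => if Q E then (1 : ℝ) else 0)
    (predIndicator_monotone hP) (predIndicator_monotone hQ)
  simp only [predIndicator_eq_indicator (fun ω => P (⋃ s ∈ S, openEdgeCluster ω s)),
    predIndicator_eq_indicator (fun ω => Q (⋃ t ∈ T, openEdgeCluster ω t)),
    setIntegral_indicator_one_eq, setIntegral_indicator_mul_indicator_eq] at key
  exact key

/-- **Two-set BHK, event form, same side.**  Given `D = {S ↮ T}`: for `P` increasing and `R` decreasing, both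
on `C_S`,  `μ(D) · μ(D ∩ ({P} ∩ {R})) ≤ μ(D ∩ {P}) · μ(D ∩ {R})`  (Kozma–Nitzan Lemma 1(ii) shape).
[cite: VandenbergHaggstromKahn2005, Thm. 1.3 with sets (Remark 1, p. 5) — event corollary; KozmaNitzan2024, Lemma 1(ii) p. 5] -/
theorem sameSide_neg (w : Sym2 (Fin n) → unitInterval) (S T : Set (Fin n))
    (P R : Set (Sym2 (Fin n)) → Prop)
    (hP : ∀ ⦃C C' : Set (Sym2 (Fin n))⦄, C ⊆ C' → P C → P C')
    (hR : ∀ ⦃C C' : Set (Sym2 (Fin n))⦄, C ⊆ C' → R C' → R C) :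
    (prodBernoulli w).real {ω : BondConfig (Fin n) | ∀ s ∈ S, ∀ t ∈ T, ¬ (openGraph ω).Reachable s t} *
      (prodBernoulli w).real ({ω : BondConfig (Fin n) | ∀ s ∈ S, ∀ t ∈ T, ¬ (openGraph ω).Reachable s t} ∩
        ({ω | P (⋃ s ∈ S, openEdgeCluster ω s)} ∩ {ω | R (⋃ s ∈ S, openEdgeCluster ω s)})) ≤
    (prodBernoulli w).real ({ω : BondConfig (Fin n) | ∀ s ∈ S, ∀ t ∈ T, ¬ (openGraph ω).Reachable s t} ∩
        {ω | P (⋃ s ∈ S, openEdgeCluster ω s)}) *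
      (prodBernoulli w).real ({ω : BondConfig (Fin n) | ∀ s ∈ S, ∀ t ∈ T, ¬ (openGraph ω).Reachable s t} ∩
        {ω | R (⋃ s ∈ S, openEdgeCluster ω s)}) := by
  classical
  have key := BHK2006_twoSetConditionalAssociation w S T
    (fun C _ => if P C then (1 : ℝ) else 0) (fun C _ => -(if R C then (1 : ℝ) else 0))
    (fun _ => predIndicator_monotone hP) (fun _ => antitone_const)
    (fun _ => neg_ite_monotone_of_antitone hR) (fun _ => antitone_const)
  simp only [predIndicator_eq_indicator (fun ω => P (⋃ s ∈ S, openEdgeCluster ω s)),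
    predIndicator_eq_indicator (fun ω => R (⋃ s ∈ S, openEdgeCluster ω s)),
    integral_neg, mul_neg, neg_le_neg_iff,
    setIntegral_indicator_one_eq, setIntegral_indicator_mul_indicator_eq] at key
  linarith


/-- `{S ↮ T}` in `openConn` form. [folklore] -/
theorem sep_coe_eq (W T : Finset (Fin n)) :
    {ω : BondConfig (Fin n) | ∀ s ∈ (↑W : Set (Fin n)), ∀ t ∈ (↑T : Set (Fin n)),
        ¬ (openGraph ω).Reachable s t} = {ω | ∀ x ∈ W, ∀ y ∈ T, ω ∉ openConn x y} := by
  ext ω; simp only [Set.mem_setOf_eq, Finset.mem_coe]; exact Iff.rfl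

/-- `{o ↔ W}` read off `C_W`. [folklore] -/
theorem reach_pred_eq (o : Fin n) (W : Finset (Fin n)) :
    {ω : BondConfig (Fin n) | ∃ x ∈ W, (SimpleGraph.fromEdgeSet
        (⋃ s ∈ (↑W : Set (Fin n)), openEdgeCluster ω s)).Reachable x o} =
      {ω | ∃ x ∈ W, ω ∈ openConn o x} := by
  ext ω
  simp only [Set.mem_setOf_eq]
  constructor
  · rintro ⟨x, hx, h⟩
    exact ⟨x, hx, ((reachable_clusterUnion_iff ω _ (Finset.mem_coe.2 hx) o).1 h).symm⟩
  · rintro ⟨x, hx, h⟩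
    exact ⟨x, hx, (reachable_clusterUnion_iff ω _ (Finset.mem_coe.2 hx) o).2
      (SimpleGraph.Reachable.symm h)⟩

/-- `{o ↔ u}` read off `C_u`. [folklore] -/
theorem conn_pred_eq (o u : Fin n) :
    {ω : BondConfig (Fin n) | (SimpleGraph.fromEdgeSet
        (⋃ s ∈ ({u} : Set (Fin n)), openEdgeCluster ω s)).Reachable u o} = openConn o u := by
  ext ω; simp only [Set.mem_setOf_eq]
  rw [reachable_clusterUnion_iff ω ({u} : Set (Fin n)) (Set.mem_singleton u) o]
  exact ⟨fun h => h.symm, fun h => SimpleGraph.Reachable.symm h⟩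

/-- **Rider lemma.**  `μ = prodBernoulli w`; `W, T` vertex sets, `D = {W ↮ T}`; `E = {o ↔ W}` (some vertex of `W`
joined to `o`); `I = {W internally connected}`; `Q = {p.1 ↮ p.2 ∀ p ∈ P}` with every `p.1 ∈ T`.  Then
`μ(D ∩ E) · μ(D ∩ (I ∩ Q)) ≤ μ(D) · μ(D ∩ (E ∩ (I ∩ Q)))`, i.e. `P(o ↔ W | D, I, Q) ≥ P(o ↔ W | D)`:
conditioning a separated block on being internally connected (increasing on `C_W`) and on extra separations
among the other side (decreasing on `C_T`) does not lower the observer's attachment rate.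
[cite: KozmaNitzan2024, Lemma 1(i) p. 5 (mechanism); VandenbergHaggstromKahn2005, Thm. 2.1 at q = 1 — corollary] -/
theorem rider (w : Sym2 (Fin n) → unitInterval) (W T : Finset (Fin n)) (o : Fin n)
    (P : Finset (Fin n × Fin n)) (hP : ∀ p ∈ P, p.1 ∈ T) :
    (prodBernoulli w).real ({ω | ∀ x ∈ W, ∀ y ∈ T, ω ∉ openConn x y} ∩ {ω | ∃ x ∈ W, ω ∈ openConn o x}) *
      (prodBernoulli w).real ({ω | ∀ x ∈ W, ∀ y ∈ T, ω ∉ openConn x y} ∩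
        ({ω | ∀ x ∈ W, ∀ y ∈ W, ω ∈ openConn x y} ∩ {ω | ∀ p ∈ P, ω ∉ openConn p.1 p.2})) ≤
    (prodBernoulli w).real {ω | ∀ x ∈ W, ∀ y ∈ T, ω ∉ openConn x y} *
      (prodBernoulli w).real ({ω | ∀ x ∈ W, ∀ y ∈ T, ω ∉ openConn x y} ∩
        ({ω | ∃ x ∈ W, ω ∈ openConn o x} ∩
          ({ω | ∀ x ∈ W, ∀ y ∈ W, ω ∈ openConn x y} ∩ {ω | ∀ p ∈ P, ω ∉ openConn p.1 p.2}))) := by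
  have key := twoSet_pos w (↑W : Set (Fin n)) (↑T : Set (Fin n))
    (fun C => ∃ x ∈ W, (SimpleGraph.fromEdgeSet C).Reachable x o)
    (fun C => ∀ x ∈ W, ∀ y ∈ W, (SimpleGraph.fromEdgeSet C).Reachable x y)
    (fun E => ∀ p ∈ P, ¬ (SimpleGraph.fromEdgeSet E).Reachable p.1 p.2)
    (fun C C' hCC' ⟨x, hx, h⟩ => ⟨x, hx, reachable_fromEdgeSet_mono hCC' h⟩)
    (fun C C' hCC' h x hx y hy => reachable_fromEdgeSet_mono hCC' (h x hx y hy))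
    (fun E E' hEE' h p hp hr => h p hp (reachable_fromEdgeSet_mono hEE' hr))
  have hIQ : {ω : BondConfig (Fin n) |
      (∀ x ∈ W, ∀ y ∈ W, (SimpleGraph.fromEdgeSet
          (⋃ s ∈ (↑W : Set (Fin n)), openEdgeCluster ω s)).Reachable x y) ∧
        ∀ p ∈ P, ¬ (SimpleGraph.fromEdgeSet
          (⋃ t ∈ (↑T : Set (Fin n)), openEdgeCluster ω t)).Reachable p.1 p.2} =
      {ω | ∀ x ∈ W, ∀ y ∈ W, ω ∈ openConn x y} ∩ {ω | ∀ p ∈ P, ω ∉ openConn p.1 p.2} := by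
    ext ω
    simp only [Set.mem_setOf_eq, Set.mem_inter_iff]
    constructor
    · rintro ⟨h1, h2⟩
      refine ⟨fun x hx y hy => (reachable_clusterUnion_iff ω _ (Finset.mem_coe.2 hx) y).1 (h1 x hx y hy),
        fun p hp hr => h2 p hp ?_⟩
      exact (reachable_clusterUnion_iff ω _ (Finset.mem_coe.2 (hP p hp)) p.2).2 hr
    · rintro ⟨h1, h2⟩
      refine ⟨fun x hx y hy => (reachable_clusterUnion_iff ω _ (Finset.mem_coe.2 hx) y).2 (h1 x hx y hy),
        fun p hp hr => h2 p hp ?_⟩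
      exact (reachable_clusterUnion_iff ω _ (Finset.mem_coe.2 (hP p hp)) p.2).1 hr
  rw [sep_coe_eq, reach_pred_eq, hIQ] at key
  exact key

/-- The events `M ∩ {o ↔ u}`, `u ∈ U`, are pairwise disjoint when `M` separates the points of `U`
from all other relays. [folklore] -/
theorem pairwiseDisjoint_conn_inter (A U : Finset (Fin n)) (hUA : U ⊆ A) (o : Fin n)
    (M : Set (BondConfig (Fin n)))
    (hM : M ⊆ {ω | ∀ u ∈ U, ∀ y ∈ A.erase u, ω ∉ openConn u y}) :
    (↑U : Set (Fin n)).PairwiseDisjoint fun u => M ∩ openConn o u := by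
  intro u hu u' hu' hne
  simp only [Function.onFun]
  refine Set.disjoint_left.2 fun ω hω hω' => ?_
  have h1 : (openGraph ω).Reachable u u' :=
    (SimpleGraph.Reachable.symm hω.2).trans hω'.2
  exact hM hω.1 u (Finset.mem_coe.1 hu) u'
    (Finset.mem_erase.2 ⟨hne.symm, hUA (Finset.mem_coe.1 hu')⟩) h1

/-- **Kozma–Nitzan Lemma 2, ratio form for designated singletons.**  `μ = prodBernoulli w`, relays `A`,
a block `W ⊆ A`, designated singletons `U ⊆ W`, observer `o`; `D_W = {W ↮ A∖W}`, `D_u = {u ↮ A∖u}`.  If the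
event `M = D_W ∩ {every u ∈ U separated from A∖u}` is non-null, then
`(Σ_{u ∈ U} μ(D_u ∩ {o↔u}) / μ(D_u)) · μ(D_W) ≤ μ(D_W ∩ {o ↔ W})`, i.e. `Σ_u φ({u}) ≤ φ(W)`.
Proof as printed: Lemma 1(i) per `u` (`twoSet_pos`, the other separations being decreasing on `C_{A∖u}`),
disjointness of `{o↔u} ∩ M`, and Lemma 1(ii) for `W` (`sameSide_neg`, the internal separations being decreasing
on `C_W`). [cite: KozmaNitzan2024, Lemma 2 (p. 6)] -/
theorem lemma2_ratio (w : Sym2 (Fin n) → unitInterval) (A W U : Finset (Fin n)) (hWA : W ⊆ A)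
    (hUW : U ⊆ W) (o : Fin n)
    (hM : 0 < (prodBernoulli w).real ({ω | ∀ x ∈ W, ∀ y ∈ A \ W, ω ∉ openConn x y} ∩
      {ω | ∀ u ∈ U, ∀ y ∈ A.erase u, ω ∉ openConn u y})) :
    (∑ u ∈ U, (prodBernoulli w).real ({ω | ∀ y ∈ A.erase u, ω ∉ openConn u y} ∩ openConn o u) /
        (prodBernoulli w).real {ω | ∀ y ∈ A.erase u, ω ∉ openConn u y}) *
      (prodBernoulli w).real {ω | ∀ x ∈ W, ∀ y ∈ A \ W, ω ∉ openConn x y} ≤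
    (prodBernoulli w).real ({ω | ∀ x ∈ W, ∀ y ∈ A \ W, ω ∉ openConn x y} ∩
      {ω | ∃ x ∈ W, ω ∈ openConn o x}) := by
  set μ := prodBernoulli w with hμ
  set DW : Set (BondConfig (Fin n)) := {ω | ∀ x ∈ W, ∀ y ∈ A \ W, ω ∉ openConn x y} with hDW
  set M : Set (BondConfig (Fin n)) := DW ∩ {ω | ∀ u ∈ U, ∀ y ∈ A.erase u, ω ∉ openConn u y} with hMdef
  set EW : Set (BondConfig (Fin n)) := {ω | ∃ x ∈ W, ω ∈ openConn o x} with hEW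
  have hUA : U ⊆ A := hUW.trans hWA
  have hMpos := hM
  -- positivity of the conditionings
  have hM_sub_Du : ∀ u ∈ U, M ⊆ {ω | ∀ y ∈ A.erase u, ω ∉ openConn u y} :=
    fun u hu ω hω => hω.2 u hu
  have hM_sub_DW : M ⊆ DW := fun ω hω => hω.1
  have hDu_pos : ∀ u ∈ U, 0 < μ.real {ω | ∀ y ∈ A.erase u, ω ∉ openConn u y} :=
    fun u hu => lt_of_lt_of_le hMpos (measureReal_mono (hM_sub_Du u hu))
  have hDW_pos : 0 < μ.real DW := lt_of_lt_of_le hMpos (measureReal_mono hM_sub_DW)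
  -- Step 1: Lemma 1(i) per designated singleton
  have step1 : ∀ u ∈ U,
      μ.real ({ω | ∀ y ∈ A.erase u, ω ∉ openConn u y} ∩ openConn o u) * μ.real M ≤
        μ.real {ω | ∀ y ∈ A.erase u, ω ∉ openConn u y} * μ.real (M ∩ openConn o u) := by
    intro u hu
    have key := twoSet_pos w ({u} : Set (Fin n)) (↑(A.erase u) : Set (Fin n))
      (fun C => (SimpleGraph.fromEdgeSet C).Reachable u o) (fun _ => True)
      (fun E => (∀ x ∈ W, x ≠ u → ∀ y ∈ A \ W, ¬ (SimpleGraph.fromEdgeSet E).Reachable x y) ∧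
        (∀ u' ∈ U, u' ≠ u → ∀ y ∈ A.erase u', ¬ (SimpleGraph.fromEdgeSet E).Reachable u' y))
      (fun C C' hCC' h => reachable_fromEdgeSet_mono hCC' h) (fun _ _ _ h => h)
      (fun E E' hEE' h => ⟨fun x hx hxu y hy hr => h.1 x hx hxu y hy (reachable_fromEdgeSet_mono hEE' hr),
        fun u' hu' hne y hy hr => h.2 u' hu' hne y hy (reachable_fromEdgeSet_mono hEE' hr)⟩)
    have hD : {ω : BondConfig (Fin n) | ∀ s ∈ ({u} : Set (Fin n)), ∀ t ∈ (↑(A.erase u) : Set (Fin n)),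
        ¬ (openGraph ω).Reachable s t} = {ω | ∀ y ∈ A.erase u, ω ∉ openConn u y} := by
      ext ω
      simp only [Set.mem_setOf_eq, Set.mem_singleton_iff, forall_eq, Finset.mem_coe]
      exact Iff.rfl
    have hR : {ω : BondConfig (Fin n) | ∀ y ∈ A.erase u, ω ∉ openConn u y} ∩
        {ω | True ∧ ((∀ x ∈ W, x ≠ u → ∀ y ∈ A \ W, ¬ (SimpleGraph.fromEdgeSet
            (⋃ t ∈ (↑(A.erase u) : Set (Fin n)), openEdgeCluster ω t)).Reachable x y) ∧
          (∀ u' ∈ U, u' ≠ u → ∀ y ∈ A.erase u', ¬ (SimpleGraph.fromEdgeSet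
            (⋃ t ∈ (↑(A.erase u) : Set (Fin n)), openEdgeCluster ω t)).Reachable u' y))} = M := by
      ext ω
      simp only [Set.mem_inter_iff, Set.mem_setOf_eq, true_and, hMdef, hDW]
      constructor
      · rintro ⟨h0, h1, h2⟩
        refine ⟨fun x hx y hy => ?_, fun u' hu' y hy => ?_⟩
        · by_cases hxu : x = u
          · subst hxu
            exact h0 y (Finset.mem_erase.2 ⟨fun h => (Finset.mem_sdiff.1 hy).2 (h ▸ hx),
              (Finset.mem_sdiff.1 hy).1⟩)
          · intro hr
            exact h1 x hx hxu y hy ((reachable_clusterUnion_iff ω _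
              (Finset.mem_coe.2 (Finset.mem_erase.2 ⟨hxu, hWA hx⟩)) y).2 hr)
        · by_cases huu : u' = u
          · subst huu; exact h0 y hy
          · intro hr
            exact h2 u' hu' huu y hy ((reachable_clusterUnion_iff ω _
              (Finset.mem_coe.2 (Finset.mem_erase.2 ⟨huu, hUA hu'⟩)) y).2 hr)
      · rintro ⟨h1, h2⟩
        refine ⟨h2 u hu, fun x hx hxu y hy hr => ?_, fun u' hu' huu y hy hr => ?_⟩
        · exact h1 x hx y hy ((reachable_clusterUnion_iff ω _
            (Finset.mem_coe.2 (Finset.mem_erase.2 ⟨hxu, hWA hx⟩)) y).1 hr)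
        · exact h2 u' hu' y hy ((reachable_clusterUnion_iff ω _
            (Finset.mem_coe.2 (Finset.mem_erase.2 ⟨huu, hUA hu'⟩)) y).1 hr)
    rw [hD, conn_pred_eq] at key
    rw [← Set.inter_assoc, hR] at key
    -- `key : μ(D_u ∩ conn) * μ(M) ≤ μ(D_u) * μ((D_u ∩ conn) ∩ R')`; identify the last set with `M ∩ conn`
    have hlast : {ω : BondConfig (Fin n) | ∀ y ∈ A.erase u, ω ∉ openConn u y} ∩ openConn o u ∩
        {ω | True ∧ ((∀ x ∈ W, x ≠ u → ∀ y ∈ A \ W, ¬ (SimpleGraph.fromEdgeSet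
            (⋃ t ∈ (↑(A.erase u) : Set (Fin n)), openEdgeCluster ω t)).Reachable x y) ∧
          (∀ u' ∈ U, u' ≠ u → ∀ y ∈ A.erase u', ¬ (SimpleGraph.fromEdgeSet
            (⋃ t ∈ (↑(A.erase u) : Set (Fin n)), openEdgeCluster ω t)).Reachable u' y))} =
        M ∩ openConn o u := by
      rw [Set.inter_assoc, Set.inter_comm (openConn o u), ← Set.inter_assoc, hR]
    rw [hlast] at key
    exact key
  -- Step 2: disjointness under `M`
  have step2 : ∑ u ∈ U, μ.real (M ∩ openConn o u) ≤ μ.real (M ∩ EW) := by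
    rw [← measureReal_biUnion_finset (pairwiseDisjoint_conn_inter A U hUA o M (fun ω hω => hω.2))
      (fun u _ => MeasurableSet.of_discrete)]
    refine measureReal_mono (Set.iUnion₂_subset fun u hu ω hω => ⟨hω.1, u, hUW (Finset.mem_coe.1 hu), hω.2⟩)
  -- Step 3: Lemma 1(ii) for the block `W`
  have step3 : μ.real DW * μ.real (M ∩ EW) ≤ μ.real (DW ∩ EW) * μ.real M := by
    have key := sameSide_neg w (↑W : Set (Fin n)) (↑(A \ W) : Set (Fin n))
      (fun C => ∃ x ∈ W, (SimpleGraph.fromEdgeSet C).Reachable x o)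
      (fun C => ∀ u ∈ U, ∀ y ∈ W, y ≠ u → ¬ (SimpleGraph.fromEdgeSet C).Reachable u y)
      (fun C C' hCC' ⟨x, hx, h⟩ => ⟨x, hx, reachable_fromEdgeSet_mono hCC' h⟩)
      (fun C C' hCC' h u hu y hy hne hr => h u hu y hy hne (reachable_fromEdgeSet_mono hCC' hr))
    have hI : {ω : BondConfig (Fin n) | ∀ x ∈ W, ∀ y ∈ A \ W, ω ∉ openConn x y} ∩
        {ω | ∀ u ∈ U, ∀ y ∈ W, y ≠ u → ¬ (SimpleGraph.fromEdgeSet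
          (⋃ s ∈ (↑W : Set (Fin n)), openEdgeCluster ω s)).Reachable u y} = M := by
      ext ω
      simp only [Set.mem_inter_iff, Set.mem_setOf_eq, hMdef, hDW]
      constructor
      · rintro ⟨h1, h2⟩
        refine ⟨h1, fun u hu y hy => ?_⟩
        obtain ⟨hyu, hyA⟩ := Finset.mem_erase.1 hy
        by_cases hyW : y ∈ W
        · intro hr
          exact h2 u hu y hyW hyu ((reachable_clusterUnion_iff ω _ (Finset.mem_coe.2 (hUW hu)) y).2 hr)
        · exact h1 u (hUW hu) y (Finset.mem_sdiff.2 ⟨hyA, hyW⟩)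
      · rintro ⟨h1, h2⟩
        refine ⟨h1, fun u hu y hy hne hr => ?_⟩
        exact h2 u hu y (Finset.mem_erase.2 ⟨hne, hWA hy⟩)
          ((reachable_clusterUnion_iff ω _ (Finset.mem_coe.2 (hUW hu)) y).1 hr)
    rw [sep_coe_eq, reach_pred_eq] at key
    have hI' : {ω : BondConfig (Fin n) | ∀ x ∈ W, ∀ y ∈ A \ W, ω ∉ openConn x y} ∩
        ({ω | ∃ x ∈ W, ω ∈ openConn o x} ∩ {ω | ∀ u ∈ U, ∀ y ∈ W, y ≠ u → ¬ (SimpleGraph.fromEdgeSet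
          (⋃ s ∈ (↑W : Set (Fin n)), openEdgeCluster ω s)).Reachable u y}) = M ∩ EW := by
      rw [Set.inter_left_comm, hI, Set.inter_comm]
    rw [hI', hI] at key
    exact key
  -- assembly of the three steps
  have hm : 0 < μ.real M := hMpos
  have hsum1 : ∀ u ∈ U,
      μ.real ({ω | ∀ y ∈ A.erase u, ω ∉ openConn u y} ∩ openConn o u) /
          μ.real {ω | ∀ y ∈ A.erase u, ω ∉ openConn u y} ≤ μ.real (M ∩ openConn o u) / μ.real M := by
    intro u hu
    rw [div_le_div_iff₀ (hDu_pos u hu) hm]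
    linarith [step1 u hu, mul_comm (μ.real (M ∩ openConn o u))
      (μ.real {ω | ∀ y ∈ A.erase u, ω ∉ openConn u y})]
  calc (∑ u ∈ U, μ.real ({ω | ∀ y ∈ A.erase u, ω ∉ openConn u y} ∩ openConn o u) /
          μ.real {ω | ∀ y ∈ A.erase u, ω ∉ openConn u y}) * μ.real DW
      ≤ (∑ u ∈ U, μ.real (M ∩ openConn o u) / μ.real M) * μ.real DW :=
        mul_le_mul_of_nonneg_right (Finset.sum_le_sum hsum1) measureReal_nonneg
    _ = (∑ u ∈ U, μ.real (M ∩ openConn o u)) / μ.real M * μ.real DW := by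
        rw [Finset.sum_div]
    _ ≤ μ.real (M ∩ EW) / μ.real M * μ.real DW := by
        gcongr
    _ ≤ μ.real (DW ∩ EW) := by
        rw [div_mul_eq_mul_div, div_le_iff₀ hm]
        calc μ.real (M ∩ EW) * μ.real DW = μ.real DW * μ.real (M ∩ EW) := mul_comm _ _
          _ ≤ μ.real (DW ∩ EW) * μ.real M := step3

end TwoLevelLonelyRelay

end Summit.CriticalPhenomena.PercolationContinuityZ3.Theorems
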